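import Summits.Langlands.Langlands.Theorems.IrreducibilityBySelfDualityPairLBoundaryJSCornerGlobalTranslate

/-!
# The gap global theorem in TRANSLATE form for `GL_n × GL_m` — part 1: the torus elements `T = ι(τ) D` and the
# torus substitution `a ↦ τ a` for a general first factor

Summit `Langlands`, sub-problem `Langlands`, helper file under `Theorems/` supporting the crux
`PairLBoundaryJS` (stmt-Langlands-13622), line `Sketch`, registered stub `stub_gap_global_translate` (G-GT)
of the GAP ROAD (skeleton v19, lead c6): the `GL_n × GL_m` analogue of
`CornerGlobalTranslate.stub_corner_global_translate`, `ι = glCorner (m ≤ n) : h ↦ diag(h, 1_{n-m})`.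

Everything is at the TORUS parameter `s` of `torusPairIntegrandC` (the printed `Ψ(s + (n-m)/2; W, W')`).
Inputs, all as HYPOTHESES of the main theorem `exists_entire_eq_translate_of` (so that this file lands
before the three sibling results do): (E) the analytic clause of Cogdell (2004), Thm. 2.1 in unfolded form —
for honest `A_G`-invariant cusp forms `φ` on `GL_n(𝔸_K)`, `φ'` on `GL_m(𝔸_K)` the unfolded torus integral
`U(s; φ, φ') = ∫ torusPairIntegrandC m K (W_φ ∘ ι) (star ∘ W_{φ'}) 1 s` has an entire continuation (the
named fact `stub_gap_entire_fact`); (Ac) one-factor absolute convergence (`stub_gap_abs_convergence`);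
(EL) the Euler factorisation over all good places (`stub_gap_euler_limit`). Assembly
(`exists_entire_eq_translate_of`): for torus elements `τ ∈ (𝔸_Kˣ)ᵐ`, `T ∈ (𝔸_Kˣ)ⁿ` with `T_i = τ_i`
(`i < m`) and `T` trivial at infinity, put `D = diag(1_m, T_m, …, T_{n-1})` (finite-adelic); the right
translate `r(D) φ` of `φ = invQuot Φ` is an honest `A_G`-invariant cusp form
(`IsCuspFormGL.rightTranslation_gl`) with `W_{r(D)φ}(g) = W_φ(g D)` (`whittakerCoeff_mul_right`); (E) at
`(r(D) φ, φ')` gives the entire `J`; the torus substitution `a ↦ τ a` (`torusPoint_mul`, `torusWeightC_mul`,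
left invariance of `νA`) turns `W_{r(D)φ}(ι(ak))` into `W_φ(ι(diag τ) ι(ak) D) = W_φ(diag(T) ι(ak))`
(`ι(diag τ) D = diag T`, `D ι(g) = ι(g) D`: `glCorner_glDiagonal_mul_glDiagonal_eq`,
`glDiagonal_mul_glCorner_comm`); the honest translated unramified data at `v ∉ S'`
(`HonestTranslateUnramified.exists_isTorusUnramifiedAt_whittakerCoeff_of_ae_eq_translate` at `GL_n` with
`T = diag T` and at `GL_m` with `T = diag τ`, `IsTorusUnramifiedAt.star`, `.of_valued_eq`), the Satake bounds,
the central character of `π`, (Ac) at `r(D) φ` for the integrability, (EL) and the Euler product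
`hasProd_partialPairL` at `s + (n-m)/2`.

## References

* J. W. Cogdell, *Analytic theory of L-functions for GL_n*, in *An Introduction to the Langlands
  Program* (2004), §2.2 (PDF pp. 182–184), Thm. 2.1–2.2, §3.1 Thm. 3.3, §4.2 [CogdellAnalyticTheory2004].
* H. Jacquet, I. I. Piatetski-Shapiro, J. Shalika, *Rankin–Selberg convolutions*, Amer. J. Math.
  105 (1983), §2 [JacquetPiatetskiShapiroShalika1983].
-/

noncomputable section

-- `Summit.Langlands.Langlands.…` (summit = sub-problem name, D-0017 layout) trips `dupNamespace`
set_option linter.dupNamespace false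

open scoped MatrixGroups Topology Pointwise ENNReal NNReal ComplexConjugate InnerProductSpace ContDiff
-- the place subtypes indexing `mixedSpace K` are `Fintype` classically (`NormedCommRing (mixedSpace K)`)
open scoped Classical Matrix.Norms.Operator
open NumberField IsDedekindDomain MeasureTheory Measure Matrix Set Filter WithZero
open NumberField.mixedEmbedding
open Literature.NumberTheory.Automorphic AdelicGroupData
open Literature.NumberTheory.GaloisRepresentations (ideleGroup HeckeCharacter)
open Literature.MeasureTheory.Group
open Literature.RingTheory.SymmetricFunctions.SymmPoly
open ValuativeRel

-- the automorphic quotient carries the tree's Borel σ-algebra, not Mathlib's quotient σ-algebra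
attribute [-instance] Quotient.instMeasurableSpace QuotientGroup.measurableSpace

-- the house local instances, exactly as in `RankinSelbergUnfoldingIdentity`
attribute [local instance] adelicBorel borelSpace_adelic locallyCompactSpace_adelic secondCountableTopology_gl_adelic
  glAdeleBorel borelSpace_glAdele borelSpace_ideleGroup secondCountableTopology_ideleGroup

-- Mathlib idiom: the commutator Lie ring on matrices, to mention `(archGroupGL n K).lie`
attribute [local instance 100] LieRing.ofAssociativeRing

namespace Summit.Langlands.Langlands.Theorems.GapGlobalTranslatePart1

/-! ### Two matrix identities for the torus elements `T = ι(τ) D` -/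

section Matrices

variable {n m : ℕ} {R : Type*} [CommRing R]

/-- **`ι(diag τ) · diag D = diag T`** when `T_i = τ_i` for `i < m`, `D_i = 1` for `i < m` and `D_i = T_i` for
`i ≥ m` (`ι = glCorner (m ≤ n)`). [folklore] -/
theorem glCorner_glDiagonal_mul_glDiagonal_eq (hmn : m ≤ n) (τ : Fin m → Rˣ) (T D : Fin n → Rˣ)
    (hTτ : ∀ i : Fin m, T (Fin.castLE hmn i) = τ i) (hD₁ : ∀ i : Fin n, (i : ℕ) < m → D i = 1)
    (hD₂ : ∀ i : Fin n, m ≤ (i : ℕ) → D i = T i) :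
    glCorner R hmn (glDiagonal m R τ) * glDiagonal n R D = glDiagonal n R T := by
  refine Matrix.GeneralLinearGroup.ext fun i j => ?_
  rw [Units.val_mul, coe_glDiagonal, coe_glDiagonal, Matrix.mul_diagonal, glCorner_apply_val, coe_glDiagonal,
    Matrix.diagonal_apply]
  by_cases hi : (i : ℕ) < m <;> by_cases hj : (j : ℕ) < m
  · rw [dif_pos hi, dif_pos hj, Matrix.diagonal_apply]
    by_cases hij : i = j
    · subst hij
      rw [if_pos rfl, if_pos rfl, hD₁ i hi, Units.val_one, mul_one, ← hTτ ⟨i, hi⟩]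
      rfl
    · have hij' : (⟨i, hi⟩ : Fin m) ≠ ⟨j, hj⟩ := fun h => hij (Fin.ext (Fin.mk.inj_iff.mp h))
      rw [if_neg hij', if_neg hij, zero_mul]
  · rw [dif_pos hi, dif_neg hj, zero_mul]
    have hij : i ≠ j := fun h => hj (h ▸ hi)
    rw [if_neg hij]
  · rw [dif_neg hi, if_pos hj, zero_mul]
    have hij : i ≠ j := fun h => hi (h ▸ hj)
    rw [if_neg hij]
  · rw [dif_neg hi, if_neg hj]
    by_cases hij : i = j
    · subst hij
      rw [if_pos rfl, if_pos rfl, one_mul, hD₂ i (not_lt.1 hi)]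
    · rw [if_neg hij, if_neg hij, zero_mul]

/-- **`diag D` commutes with the corner `ι(g)`** when `D_i = 1` for `i < m`. [folklore] -/
theorem glDiagonal_mul_glCorner_comm (hmn : m ≤ n) (D : Fin n → Rˣ) (hD₁ : ∀ i : Fin n, (i : ℕ) < m → D i = 1)
    (g : GL (Fin m) R) :
    glDiagonal n R D * glCorner R hmn g = glCorner R hmn g * glDiagonal n R D := by
  refine Matrix.GeneralLinearGroup.ext fun i j => ?_
  rw [Units.val_mul, Units.val_mul, coe_glDiagonal, Matrix.mul_diagonal, Matrix.diagonal_mul,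
    glCorner_apply_val]
  by_cases hi : (i : ℕ) < m <;> by_cases hj : (j : ℕ) < m
  · rw [dif_pos hi, dif_pos hj, hD₁ i hi, hD₁ j hj, Units.val_one, one_mul, mul_one]
  · rw [dif_pos hi, dif_neg hj, mul_zero, zero_mul]
  · rw [dif_neg hi, if_pos hj, mul_zero, zero_mul]
  · rw [dif_neg hi, if_neg hj]
    by_cases hij : i = j
    · subst hij; rw [if_pos rfl, mul_one, one_mul]
    · rw [if_neg hij, mul_zero, zero_mul]

end Matrices

/-! ### The torus substitution `a ↦ τ a` for a general first factor -/

section Translate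

variable {m : ℕ} {K : Type} [Field K] [NumberField K]

local notation "𝔸" => AdeleRing (𝓞 K) K

/-- **The pair integrand at a translated torus point**, for an arbitrary first factor `f` on `GL_m(𝔸_K)`
and the test function `1`: `I_s(τ a, k) = w_s(τ) · I^τ_s(a, k)`, `I^τ` the integrand of the left translates
`f(diag τ ·)`, `W₂(diag τ ·)` (`diag(τ a) k = diag τ · diag(a) k`, multiplicativity of the weight). [folklore] -/
theorem torusPairIntegrandC_translate (f W₂ : GL (Fin m) 𝔸 → ℂ) (τ : Fin m → ideleGroup K) (s : ℂ)
    (p : (Fin m → ideleGroup K) × ↥(maximalCompactAdelic m K)) :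
    torusPairIntegrandC m K f W₂ (fun _ => (1 : ℝ)) s (τ * p.1, p.2) =
      torusWeightC m K s τ * torusPairIntegrandC m K (fun g => f (glDiagonal m 𝔸 τ * g))
        (fun g => W₂ (glDiagonal m 𝔸 τ * g)) (fun _ => (1 : ℝ)) s p := by
  obtain ⟨a, k⟩ := p
  simp only [torusPairIntegrandC]
  rw [torusPoint_mul, torusWeightC_mul]
  ring

variable [MeasurableSpace (AdeleRing (𝓞 K) K)] [BorelSpace (AdeleRing (𝓞 K) K)]
variable (νA : Measure (Fin m → ideleGroup K)) [νA.IsMulLeftInvariant] [SFinite νA]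
  (νK : Measure ↥(maximalCompactAdelic m K)) [SFinite νK]

/-- **Substituting `a ↦ τ a` in the pair integral** (general first factor):
`∫ I_s d(νA ⊗ νK) = w_s(τ) · ∫ I^τ_s d(νA ⊗ νK)` (left invariance of `νA`; no integrability needed).
[cite: CogdellAnalyticTheory2004, §3.1, Thm. 3.3] -/
theorem integral_torusPairIntegrandC_translate (f W₂ : GL (Fin m) 𝔸 → ℂ) (τ : Fin m → ideleGroup K) (s : ℂ) :
    ∫ p, torusPairIntegrandC m K f W₂ (fun _ => (1 : ℝ)) s p ∂(νA.prod νK) =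
      torusWeightC m K s τ * ∫ p, torusPairIntegrandC m K (fun g => f (glDiagonal m 𝔸 τ * g))
        (fun g => W₂ (glDiagonal m 𝔸 τ * g)) (fun _ => (1 : ℝ)) s p ∂(νA.prod νK) := by
  let e : (Fin m → ideleGroup K) × ↥(maximalCompactAdelic m K) ≃ᵐ
      (Fin m → ideleGroup K) × ↥(maximalCompactAdelic m K) :=
    (MeasurableEquiv.mulLeft τ).prodCongr (MeasurableEquiv.refl _)
  have he : ⇑e = Prod.map (τ * ·) id := rfl
  have hmp : MeasurePreserving e (νA.prod νK) (νA.prod νK) := by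
    rw [he]; exact measurePreserving_prodMap_mul_left νA νK τ
  calc ∫ p, torusPairIntegrandC m K f W₂ (fun _ => (1 : ℝ)) s p ∂(νA.prod νK)
      = ∫ p, torusPairIntegrandC m K f W₂ (fun _ => (1 : ℝ)) s (e p) ∂(νA.prod νK) :=
        (hmp.integral_comp e.measurableEmbedding _).symm
    _ = ∫ p, torusWeightC m K s τ * torusPairIntegrandC m K (fun g => f (glDiagonal m 𝔸 τ * g))
          (fun g => W₂ (glDiagonal m 𝔸 τ * g)) (fun _ => (1 : ℝ)) s p ∂(νA.prod νK) :=
        integral_congr_ae (Eventually.of_forall fun p => torusPairIntegrandC_translate f W₂ τ s p)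
    _ = _ := integral_const_mul _ _

/-- **Integrability transfers to the translated pair integrand** (general first factor). [folklore] -/
theorem integrable_torusPairIntegrandC_translate (f W₂ : GL (Fin m) 𝔸 → ℂ) (τ : Fin m → ideleGroup K) {s : ℂ}
    (hint : Integrable (torusPairIntegrandC m K f W₂ (fun _ => (1 : ℝ)) s) (νA.prod νK)) :
    Integrable (torusPairIntegrandC m K (fun g => f (glDiagonal m 𝔸 τ * g))
      (fun g => W₂ (glDiagonal m 𝔸 τ * g)) (fun _ => (1 : ℝ)) s) (νA.prod νK) := by
  let e : (Fin m → ideleGroup K) × ↥(maximalCompactAdelic m K) ≃ᵐ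
      (Fin m → ideleGroup K) × ↥(maximalCompactAdelic m K) :=
    (MeasurableEquiv.mulLeft τ).prodCongr (MeasurableEquiv.refl _)
  have he : ⇑e = Prod.map (τ * ·) id := rfl
  have hmp : MeasurePreserving e (νA.prod νK) (νA.prod νK) := by
    rw [he]; exact measurePreserving_prodMap_mul_left νA νK τ
  have hcomp : Integrable (torusPairIntegrandC m K f W₂ (fun _ => (1 : ℝ)) s ∘ e) (νA.prod νK) :=
    (hmp.integrable_comp_emb e.measurableEmbedding).2 hint
  have heq : (fun p => (torusWeightC m K s τ)⁻¹ * (torusPairIntegrandC m K f W₂ (fun _ => (1 : ℝ)) s ∘ e) p) =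
      torusPairIntegrandC m K (fun g => f (glDiagonal m 𝔸 τ * g))
        (fun g => W₂ (glDiagonal m 𝔸 τ * g)) (fun _ => (1 : ℝ)) s := by
    funext p
    rw [Function.comp_apply, he, show Prod.map (τ * ·) id p = (τ * p.1, p.2) from rfl,
      torusPairIntegrandC_translate f W₂ τ s p, ← mul_assoc, inv_mul_cancel₀ (torusWeightC_ne_zero s τ), one_mul]
  rw [← heq]
  exact hcomp.const_mul _

end Translate

/-! ### The registered sub-stub -/

/-- **SUB-STUB (G-GT, part 1) — the torus substitution `a ↦ τ a` in the pair integral with a general first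
factor**: for `νA` left invariant and s-finite, `νK` s-finite, `f`, `W₂` on `GL_m(𝔸_K)`, `τ ∈ (𝔸_Kˣ)ᵐ` and `s ∈ ℂ`:
(i) `∫ I_s = w_s(τ) ∫ I^τ_s`; (ii) integrability of `I_s` implies that of `I^τ_s` (Cogdell (2004), §3.1, Thm. 3.3).
[cite: CogdellAnalyticTheory2004, §3.1, Thm. 3.3] -/
theorem stub_gap_global_translate_part1 :
    ∀ {m : ℕ} {K : Type} [Field K] [NumberField K]
      [MeasurableSpace (AdeleRing (𝓞 K) K)] [BorelSpace (AdeleRing (𝓞 K) K)]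
      (νA : Measure (Fin m → ideleGroup K)) [νA.IsMulLeftInvariant] [SFinite νA]
      (νK : Measure ↥(maximalCompactAdelic m K)) [SFinite νK]
      (f W₂ : GL (Fin m) (AdeleRing (𝓞 K) K) → ℂ) (τ : Fin m → ideleGroup K) (s : ℂ),
    (∫ p, torusPairIntegrandC m K f W₂ (fun _ => (1 : ℝ)) s p ∂(νA.prod νK) =
      torusWeightC m K s τ * ∫ p, torusPairIntegrandC m K (fun g => f (glDiagonal m (AdeleRing (𝓞 K) K) τ * g))
        (fun g => W₂ (glDiagonal m (AdeleRing (𝓞 K) K) τ * g)) (fun _ => (1 : ℝ)) s p ∂(νA.prod νK)) ∧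
    (Integrable (torusPairIntegrandC m K f W₂ (fun _ => (1 : ℝ)) s) (νA.prod νK) →
      Integrable (torusPairIntegrandC m K (fun g => f (glDiagonal m (AdeleRing (𝓞 K) K) τ * g))
        (fun g => W₂ (glDiagonal m (AdeleRing (𝓞 K) K) τ * g)) (fun _ => (1 : ℝ)) s) (νA.prod νK)) := by
  intro m K _ _ _ _ νA _ _ νK _ f W₂ τ s
  exact ⟨integral_torusPairIntegrandC_translate νA νK f W₂ τ s, integrable_torusPairIntegrandC_translate νA νK f W₂ τ⟩

end Summit.Langlands.Langlands.Theorems.GapGlobalTranslatePart1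

end
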